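/-
Origin: expansion seat `planner-pub-hodgecm-qw8b-g5-0`, handover #1 2026-08-18T09:39:34Z (`HOME/pub-hodgecm-qw8b-g5/lean/Qw8b5/Qw8NoN4.lean`, md5 8bf153cf, 252 lines);
landed by the gen-7 packager in gate run 27 as `HodgeCM/StubTree/Qw8NoN4.lean` (import ^import Pohl9\.→import HodgeCM.Proofs.Pohlmann. ×1).
-/
/-
Copyright: pub-hodgecm formalisation cell (harness21, 2026). New file (not vendored).
Origin: HOME/pub-hodgecm-qw8b-g5/lean/Qw8b5/Qw8NoN4.lean — session planner-pub-hodgecm-qw8b-g5-0 (unit pub-hodgecm-qw8b-g5,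
QW8 SEAT 2, part (6b)(ii), generation 5).  WIP module `Qw8b5.Qw8NoN4`; intended final place `HodgeCM/StubTree/Qw8NoN4.lean`
(module `HodgeCM.StubTree.Qw8NoN4`).  ADDITIVE LEAF: replaces nothing, nothing imports it.  Imports: the landed
`HodgeCM.StubTree.Qw8GysinDescentH0` (gate run 25/26) and ONE queued WIP module `Pohl9.AnyCMFieldNoN4` (seat pohl-g9, run-27
HANDOVER #4 v3, md5 98cc61b6e583; itself importing toy2-g5's run-27 `PohlmannNoN4` bb695886d681) — to be rewritten
`HodgeCM.Proofs.Pohlmann.AnyCMFieldNoN4` at intake; this file lands AFTER both.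
-/
import Summits.HodgeConjecture.HodgeCM.StubTree.Qw8GysinDescentH0
import Summits.HodgeConjecture.HodgeCM.Proofs.Pohlmann.AnyCMFieldNoN4

/-!
# The [QW8]-side assembly without N4 `Fact_hodge_F0`

The landed [QW8] §2.5 chain `qw8MilnePos_of_facts → qw8Sufficiency_of_descentFacts → Assembly.COR_CM_of_descentFacts(B)`
(`StubTree/Qw8Milne.lean`, `Qw8GysinDescent.lean`, `Qw8GysinDescentH0.lean`, `Qw8Monomial.lean`) carries the textbook fact
N4 `Fact_hodge_F0` (`F⁰H^k = H^k`) as a binder.  N4 enters that chain at exactly ONE place: `Universe.cupC_fvec_mem_algC`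
(Qw8Milne.lean §1) rewrites Pohlmann's equality `baseChange_hodgeClassesOf_eq_iSup (M) (h29) (h30) 1` in DEGREE 2 with
`h30 := weightHodge_of_facts M hN1 hN2 hN3 hN4` (M30 in all degrees), and uses only its direction `⊇` — the weight space of
a Hodge weight of degree 2 lies in `Hdg¹(A′) ⊗ ℂ`.  M30 in degree 2 is a theorem of `ModelAxioms` + N1 + N2 alone
(`weightSpace_le_piece_succ`; packaged as `weightHodgeAt_succ_of_facts (M) (hN1) (hN2) 1 : U.Fact_weightHodgeAt (1 + 1)` in
`Proofs/Pohlmann/PohlmannNoN4.lean`, seat toy2-g5), and the direction `⊇` with M30 localised to degree `2p` is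
`weightSpace_le_baseChange_hodgeClassesOf_C_of_weightHodgeAt` (`Proofs/Pohlmann/AnyCMFieldNoN4.lean`, seat pohl-g9; Hodge
weights in the Galois-closure sense `IsHodgeWeightC`, implied by `IsHodgeWeight` — `IsHodgeWeight.isHodgeWeightC`,
`Proofs/Pohlmann/AnyCMField.lean`).  Everything downstream merely threads `hN4`; and `COR_CM` consumes `PohlmannSpan`,
which is N4-free as well (`pohlmannSpan_of_facts₃ (M) (hN1) (hN2) (hN3)`, PohlmannNoN4.lean).

This file records the N4-free chain (suffix `₃` = "three textbook facts N1–N3", as in `pohlmannSpan_of_facts₃`):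

* `Universe.cupC_fvec_mem_algC_of_weightHodgeAt (M) (h29) (h30 : U.Fact_weightHodgeAt (2 * 1))` — the pair lemma with M30
  in degree 2 only; `Universe.weightSpace_le_algC_of_lefChar_eq_zero₃`, **`Universe.qw8MilnePos_of_facts₃ (M) (hN1) (hN2) (hN3)
  (h4) (h5) : U.Qw8MilnePos`** (the proofs of Qw8Milne.lean §3/§4 verbatim, with the localised pair lemma);
* the three landed routes to `Qw8Sufficiency` / COR-CM with `hN4` deleted and nothing else changed:
  F7d — `qw8Sufficiency_of_descentFacts₃`, `qw8Milne_of_descentFacts₃`, `Assembly.COR_CM_of_descentFacts₃`;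
  F-H0 + F7d-B — `qw8Sufficiency_of_unitH0₃`, `qw8Milne_of_unitH0₃`, **`Assembly.COR_CM_of_descentFactsB₃ (U) (M) (hR) (hN1)
  (hN2) (hN3) (h4) (h5) (hu) (hb) (hd) : U.HC_CM`** (eleven binders; the landed `COR_CM_of_descentFactsB` has twelve);
  F7 + `Fact_trTop(CM)` — `qw8Sufficiency_of_genericFacts₃`, `qw8Milne_of_genericFacts₃`, `Assembly.COR_CM_of_genericFacts₃`,
  `Assembly.COR_CM_of_genericFacts₃'`;
  and the candidate-N5 corollary `qw8Milne_of_facts_fundClass₃`.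

Scope note (for the input tables).  After this file the [QW8]-side end-to-end theorem reads
`HC_CM ⇐ ModelAxioms ∧ RealisationExistsFace ∧ N1 ∧ N2 ∧ N3 ∧ F4 ∧ F5 ∧ F-H0 ∧ F7d-B ∧ Fact_dimProd`; N4 is no longer an
input of COR-CM on any of the three routes.  N4 stays load-bearing for M30 `Fact_weightHodge` itself and for the BASIS /
EQUALITY forms of Pohlmann's theorem at level 0 (`HodgeCM.Model.Toy.ToyPadH0J`: `jPadModel` satisfies M1–M28, N1–N3, F4, F5,
`Fact_dimProd`, `PohlmannSpan`, `HC_CM` and violates N4 and M30).  Nothing is cited; Lean + Mathlib axioms only; no landed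
declaration is restated or shadowed (all names are new, suffixed `₃` / `_of_weightHodgeAt`).
-/

noncomputable section

open scoped TensorProduct NumberField Classical

namespace HodgeCM

open Literature.AlgebraicGeometry.Motives (CMType HodgeStructure)
open HodgeCM.Pohlmann

namespace Universe

variable {U : Universe}

/-! ## 1. The pair lemma with M30 in degree 2 only -/

section Pairs

variable {F : CMField} {n : ℕ} {Θ : Fin (n + 1) → CMType F}
  (x : (j : Fin (n + 1)) → ((F : Type) →+* ℂ) → U.CohC (U.cmAV F (Θ j)) 1)

/-- **Complementary pairs of eigen-classes cup to algebraic divisor classes — M29 and M30 IN DEGREE 2 only.**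
`pr* x_{j,s} ∪ pr* x_{j',s'}` with `Ψ_{j',s'} = Ψ̄_{j,s}` is a weight vector of a Hodge weight of degree 2
(`isHodgeWeight_wtOf_pair`), hence — Pohlmann's theorem, direction `⊇`, in the localised form
`weightSpace_le_baseChange_hodgeClassesOf_C_of_weightHodgeAt` (M30 consumed in degree `2 = 2·1` only) — a complexified
Hodge class, hence (Lefschetz (1,1), M10) in `alg(A′) 1 ⊗ ℂ`.  Compare `cupC_fvec_mem_algC` (full M30). -/
theorem cupC_fvec_mem_algC_of_weightHodgeAt (M : U.ModelAxioms) (h29 : U.Fact_weightSpan)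
    (h30 : U.Fact_weightHodgeAt (2 * 1)) (hx : ∀ j τ, x j τ ∈ U.eigenLine F (Θ j) τ)
    (a b : Fin (n + 1) × ((F : Type) →+* ℂ)) (hτ : pullType (Θ b.1) b.2 = barCM (pullType (Θ a.1) a.2)) :
    U.cupC (U.cmProd F Θ) 1 1 (U.fvec x a) (U.fvec x b) ∈ U.algC (U.cmProd F Θ) 1 := by
  have hab : a ≠ b := by
    rintro rfl
    exact barCM_ne_self _ hτ.symm
  rw [← fmono_pair]
  have hW : U.fmono x 1 ![a, b] ∈ U.weightSpace F Θ (wtOf 1 ![a, b]) (2 * 1) :=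
    (U.mem_weightSpace_iff F Θ _ _ _).2 (isWeightVector_fmono x M hx 1 ![a, b] (injective_vecPair hab))
  -- a separating family and factor-wise multiplications (as in `baseChange_hodgeClassesOf_eq_iSup`)
  obtain ⟨j, a', c, hinj⟩ := exists_separating_family (F := (F : Type)) n
  choose Mi hMi using fun i => exists_isFactorAct M F Θ (j i) (a' i)
  have hinj' : Function.Injective (sepVal j a' c) := hinj
  have hB : U.fmono x 1 ![a, b] ∈ (U.hodgeClassesOf (U.cmProd F Θ) 1).baseChange ℂ :=
    weightSpace_le_baseChange_hodgeClassesOf_C_of_weightHodgeAt h29 h30 hMi hinj'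
      (isHodgeWeight_wtOf_pair a b hab hτ).isHodgeWeightC hW
  exact Submodule.baseChange_mono ℂ (M.lefschetz11 _) hB

end Pairs

/-! ## 2. Weight vectors with vanishing Lefschetz character are algebraic (positive degree), N1–N3 only -/

section Milne

variable {F : CMField} {n : ℕ} {Θ : Fin (n + 1) → CMType F}

/-- **Weight spaces with vanishing Lefschetz character are algebraic** (positive degree `k + 1 = 2(m+1)`), from
`ModelAxioms`, N1, N2, N3, F4, F5 — the proof of `weightSpace_le_algC_of_lefChar_eq_zero` verbatim, with M29 :=
`weightSpan_of_facts M hN1 hN3`, M30 in degree 2 := `weightHodgeAt_succ_of_facts M hN1 hN2 1`, and the localised pair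
lemma `cupC_fvec_mem_algC_of_weightHodgeAt`. -/
theorem weightSpace_le_algC_of_lefChar_eq_zero₃ [IsGalois ℚ F] (M : U.ModelAxioms) (hN1 : U.Fact_cupExterior)
    (hN2 : U.Fact_cup_hodge) (hN3 : U.Fact_pull_H0) (h4 : U.Fact_cupAlg) (h5 : U.Fact_cupAssoc) (m k : ℕ)
    (hk : k + 1 = 2 * (m + 1)) {S : Fin (n + 1) → Finset ((F : Type) →+* ℂ)} (hS : lefChar Θ S = 0) :
    U.weightSpace F Θ S (k + 1) ≤ (U.algC (U.cmProd F Θ) (m + 1)).comap (U.castC (U.cmProd F Θ) hk).toLinearMap := by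
  have h29 := weightSpan_of_facts M hN1 hN3
  have h30 : U.Fact_weightHodgeAt (2 * 1) := weightHodgeAt_succ_of_facts M hN1 hN2 1
  refine weightSpace_le_of_fmono_mem M hN1 k S _ fun x hx p hp hpS => ?_
  rw [Submodule.mem_comap]
  show U.castC _ hk (U.cupPowC (U.cmProd F Θ) k (U.fvec x ∘ p)) ∈ U.algC (U.cmProd F Θ) (m + 1)
  refine castC_cupPowC_mem_algC barCM h4 h5 (fun k => hN1 F n Θ k) (fun Ψ => barCM_barCM Ψ) barCM_ne_self
    m k hk (U.fvec x ∘ p) (fun i => pullType (Θ (p i).1) (p i).2) ?_ ?_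
  · intro i l hτ
    exact cupC_fvec_mem_algC_of_weightHodgeAt x M h29 h30 hx (p i) (p l) hτ
  · intro Ψ
    have hb := lefChar_eq_zero_balanced Θ S hS Ψ
    have hb' : (∑ j, ∑ s ∈ S j, if pullType (Θ j) s = Ψ then (1 : ℤ) else 0) =
        ∑ j, ∑ s ∈ S j, if pullType (Θ j) s = barCM Ψ then (1 : ℤ) else 0 := by
      have h' := congrArg (Nat.cast : ℕ → ℤ) hb
      simp only [Nat.cast_sum, Finset.natCast_card_filter] at h'
      convert h' using 3
    rw [← hpS, ← sum_eq_sum_wtOf p hp (fun j s => if pullType (Θ j) s = Ψ then (1 : ℤ) else 0),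
      ← sum_eq_sum_wtOf p hp (fun j s => if pullType (Θ j) s = barCM Ψ then (1 : ℤ) else 0)] at hb'
    convert hb' using 3

end Milne

/-! ## 3. `Qw8MilnePos` and the three routes to `Qw8Sufficiency`, without N4 -/

/-- **`Qw8Milne` in positive degree is a theorem of `ModelAxioms` (M1–M28), N1, N2, N3, F4, F5** — no N4
`Fact_hodge_F0` (compare `qw8MilnePos_of_facts`; same proof with `weightSpace_le_algC_of_lefChar_eq_zero₃`). -/
theorem qw8MilnePos_of_facts₃ (M : U.ModelAxioms) (hN1 : U.Fact_cupExterior) (hN2 : U.Fact_cup_hodge)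
    (hN3 : U.Fact_pull_H0) (h4 : U.Fact_cupAlg) (h5 : U.Fact_cupAssoc) : U.Qw8MilnePos := by
  intro F hG _h6 z hp hz
  obtain ⟨n, Θ, p, S, x, hx0, hxw⟩ := z
  change 0 < p at hp
  change lefChar Θ S = 0 at hz
  change x ∈ U.algC (U.cmProd F Θ) p
  obtain ⟨m, rfl⟩ : ∃ m, p = m + 1 := ⟨p - 1, by omega⟩
  have hk : 2 * m + 1 + 1 = 2 * (m + 1) := by ring
  have hx' : U.castC _ hk.symm x ∈ U.weightSpace F Θ S (2 * m + 1 + 1) :=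
    (U.mem_weightSpace_iff F Θ S _ _).2 (U.isWeightVector_castC F Θ S hk.symm hxw)
  have h := weightSpace_le_algC_of_lefChar_eq_zero₃ M hN1 hN2 hN3 h4 h5 m (2 * m + 1) hk hz hx'
  rw [Submodule.mem_comap, LinearEquiv.coe_coe, castC_castC, castC_self] at h
  exact h

/-- `Qw8Milne` from `ModelAxioms`, N1–N3, F4, F5 and the candidate fact N5 (fundamental class) — compare
`qw8Milne_of_facts_fundClass`. -/
theorem qw8Milne_of_facts_fundClass₃ (M : U.ModelAxioms) (hN1 : U.Fact_cupExterior) (hN2 : U.Fact_cup_hodge)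
    (hN3 : U.Fact_pull_H0) (h4 : U.Fact_cupAlg) (h5 : U.Fact_cupAssoc) (hN5 : U.Fact_fundClass) : U.Qw8Milne :=
  qw8Milne_of_pos_of_zero (qw8MilnePos_of_facts₃ M hN1 hN2 hN3 h4 h5) (qw8MilneZero_of_fundClass hN5)

/-- **Route F7d.**  `Qw8Sufficiency` from `ModelAxioms`, N1–N3, F4, F5, F7d `Fact_gysinDescent` and `Fact_dimProd`
(compare `qw8Sufficiency_of_descentFacts`: `hN4` deleted, nothing else changed). -/
theorem qw8Sufficiency_of_descentFacts₃ (M : U.ModelAxioms) (hN1 : U.Fact_cupExterior) (hN2 : U.Fact_cup_hodge)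
    (hN3 : U.Fact_pull_H0) (h4 : U.Fact_cupAlg) (h5 : U.Fact_cupAssoc) (h7d : U.Fact_gysinDescent)
    (hd : U.Fact_dimProd) : U.Qw8Sufficiency :=
  have hpos := qw8MilnePos_of_facts₃ M hN1 hN2 hN3 h4 h5
  have h0 := U.qw8MilneZero_of_descent M hN1 hN3 hd h7d hpos
  U.qw8Sufficiency_of_steps_pos (U.qw8ExtProdPos_of_descent M hN1 h4 h5 h7d hd)
    (U.qw8DualPushPullPos_of_descent M hN1 h4 h5 h7d hd) (qw8Milne_of_pos_of_zero hpos h0) h0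
    (qw8FaceBridge_holds M)

/-- `Qw8Milne` (all degrees) from `ModelAxioms`, N1–N3, F4, F5, F7d and `Fact_dimProd`. -/
theorem qw8Milne_of_descentFacts₃ (M : U.ModelAxioms) (hN1 : U.Fact_cupExterior) (hN2 : U.Fact_cup_hodge)
    (hN3 : U.Fact_pull_H0) (h4 : U.Fact_cupAlg) (h5 : U.Fact_cupAssoc) (h7d : U.Fact_gysinDescent)
    (hd : U.Fact_dimProd) : U.Qw8Milne :=
  have hpos := qw8MilnePos_of_facts₃ M hN1 hN2 hN3 h4 h5
  qw8Milne_of_pos_of_zero hpos (U.qw8MilneZero_of_descent M hN1 hN3 hd h7d hpos)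

/-- **Route F-H0 + F7d-B.**  `Qw8Sufficiency` from `ModelAxioms`, N1–N3, F4, F5, F-H0 `Fact_unitH0`, F7d-B
`Fact_gysinDescentB` and `Fact_dimProd` (compare `qw8Sufficiency_of_unitH0`). -/
theorem qw8Sufficiency_of_unitH0₃ (M : U.ModelAxioms) (hN1 : U.Fact_cupExterior) (hN2 : U.Fact_cup_hodge)
    (hN3 : U.Fact_pull_H0) (h4 : U.Fact_cupAlg) (h5 : U.Fact_cupAssoc) (hu : U.Fact_unitH0)
    (hb : U.Fact_gysinDescentB) (hd : U.Fact_dimProd) : U.Qw8Sufficiency :=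
  qw8Sufficiency_of_descentFacts₃ M hN1 hN2 hN3 h4 h5 (gysinDescent_of_unitH0 M hN1 h5 hd hu hb) hd

/-- `Qw8Milne` from the same reduced list. -/
theorem qw8Milne_of_unitH0₃ (M : U.ModelAxioms) (hN1 : U.Fact_cupExterior) (hN2 : U.Fact_cup_hodge)
    (hN3 : U.Fact_pull_H0) (h4 : U.Fact_cupAlg) (h5 : U.Fact_cupAssoc) (hu : U.Fact_unitH0)
    (hb : U.Fact_gysinDescentB) (hd : U.Fact_dimProd) : U.Qw8Milne :=
  qw8Milne_of_descentFacts₃ M hN1 hN2 hN3 h4 h5 (gysinDescent_of_unitH0 M hN1 h5 hd hu hb) hd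

/-- **Route F7 + `Fact_trTopCM`.**  `Qw8Sufficiency` from `ModelAxioms`, N1–N3, F4, F5, F7 `Fact_gysin`, `Fact_dimProd`
and `Fact_trTopCM` (compare `qw8Sufficiency_of_genericFacts`). -/
theorem qw8Sufficiency_of_genericFacts₃ (M : U.ModelAxioms) (hN1 : U.Fact_cupExterior) (hN2 : U.Fact_cup_hodge)
    (hN3 : U.Fact_pull_H0) (h4 : U.Fact_cupAlg) (h5 : U.Fact_cupAssoc) (h7 : U.Fact_gysin) (hd : U.Fact_dimProd)
    (ht : U.Fact_trTopCM) : U.Qw8Sufficiency :=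
  have hpos := qw8MilnePos_of_facts₃ M hN1 hN2 hN3 h4 h5
  have h0 := U.qw8MilneZero_of_genericFacts M hN1 hN3 h7 hd ht hpos
  U.qw8Sufficiency_of_steps_pos (U.qw8ExtProdPos_of_facts M hN1 h4 h5 h7 hd ht)
    (U.qw8DualPushPullPos_of_facts M hN1 h4 h5 h7 hd ht) (qw8Milne_of_pos_of_zero hpos h0) h0
    (qw8FaceBridge_holds M)

/-- `Qw8Milne` (all degrees) from `ModelAxioms`, N1–N3, F4, F5, F7 and the two generic facts. -/
theorem qw8Milne_of_genericFacts₃ (M : U.ModelAxioms) (hN1 : U.Fact_cupExterior) (hN2 : U.Fact_cup_hodge)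
    (hN3 : U.Fact_pull_H0) (h4 : U.Fact_cupAlg) (h5 : U.Fact_cupAssoc) (h7 : U.Fact_gysin) (hd : U.Fact_dimProd)
    (ht : U.Fact_trTopCM) : U.Qw8Milne :=
  have hpos := qw8MilnePos_of_facts₃ M hN1 hN2 hN3 h4 h5
  qw8Milne_of_pos_of_zero hpos (U.qw8MilneZero_of_genericFacts M hN1 hN3 h7 hd ht hpos)

end Universe

/-! ## 4. COR-CM without N4 -/

namespace Assembly

/-- **COR-CM, route F7d, without N4**: `HC_CM` from `ModelAxioms`, the face realisation, N1–N3, F4, F5, F7d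
`Fact_gysinDescent` and `Fact_dimProd` (compare `COR_CM_of_descentFacts`; `PohlmannSpan` := `pohlmannSpan_of_facts₃`). -/
theorem COR_CM_of_descentFacts₃ (U : Universe) (M : U.ModelAxioms) (hR : U.RealisationExistsFace)
    (hN1 : U.Fact_cupExterior) (hN2 : U.Fact_cup_hodge) (hN3 : U.Fact_pull_H0) (h4 : U.Fact_cupAlg)
    (h5 : U.Fact_cupAssoc) (h7d : U.Fact_gysinDescent) (hd : U.Fact_dimProd) : U.HC_CM :=
  COR_CM U M hR (U.pohlmannSpan_of_facts₃ M hN1 hN2 hN3)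
    (U.qw8Sufficiency_of_descentFacts₃ M hN1 hN2 hN3 h4 h5 h7d hd)

/-- **COR-CM, route F-H0 + F7d-B, without N4** — the [QW8]-side end-to-end theorem with ELEVEN binders:
`HC_CM ⇐ ModelAxioms ∧ RealisationExistsFace ∧ N1 ∧ N2 ∧ N3 ∧ F4 ∧ F5 ∧ F-H0 ∧ F7d-B ∧ Fact_dimProd`
(compare `COR_CM_of_descentFactsB`, twelve binders). -/
theorem COR_CM_of_descentFactsB₃ (U : Universe) (M : U.ModelAxioms) (hR : U.RealisationExistsFace)
    (hN1 : U.Fact_cupExterior) (hN2 : U.Fact_cup_hodge) (hN3 : U.Fact_pull_H0) (h4 : U.Fact_cupAlg)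
    (h5 : U.Fact_cupAssoc) (hu : U.Fact_unitH0) (hb : U.Fact_gysinDescentB) (hd : U.Fact_dimProd) : U.HC_CM :=
  COR_CM_of_descentFacts₃ U M hR hN1 hN2 hN3 h4 h5 (Universe.gysinDescent_of_unitH0 M hN1 h5 hd hu hb) hd

/-- **COR-CM, route F7 + `Fact_trTopCM`, without N4** (compare `COR_CM_of_genericFacts`). -/
theorem COR_CM_of_genericFacts₃ (U : Universe) (M : U.ModelAxioms) (hR : U.RealisationExistsFace)
    (hN1 : U.Fact_cupExterior) (hN2 : U.Fact_cup_hodge) (hN3 : U.Fact_pull_H0) (h4 : U.Fact_cupAlg)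
    (h5 : U.Fact_cupAssoc) (h7 : U.Fact_gysin) (hd : U.Fact_dimProd) (ht : U.Fact_trTopCM) : U.HC_CM :=
  COR_CM U M hR (U.pohlmannSpan_of_facts₃ M hN1 hN2 hN3)
    (U.qw8Sufficiency_of_genericFacts₃ M hN1 hN2 hN3 h4 h5 h7 hd ht)

/-- The same with the verbatim textbook fact `Fact_trTop` (compare `COR_CM_of_genericFacts'`). -/
theorem COR_CM_of_genericFacts₃' (U : Universe) (M : U.ModelAxioms) (hR : U.RealisationExistsFace)
    (hN1 : U.Fact_cupExterior) (hN2 : U.Fact_cup_hodge) (hN3 : U.Fact_pull_H0) (h4 : U.Fact_cupAlg)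
    (h5 : U.Fact_cupAssoc) (h7 : U.Fact_gysin) (hd : U.Fact_dimProd) (ht : U.Fact_trTop) : U.HC_CM :=
  COR_CM_of_genericFacts₃ U M hR hN1 hN2 hN3 h4 h5 h7 hd (U.trTopCM_of_trTop ht)

/-- The landed twelve-binder theorem is the special case with the redundant hypothesis `hN4`. -/
theorem COR_CM_of_descentFactsB_eq₃ (U : Universe) (M : U.ModelAxioms) (hR : U.RealisationExistsFace)
    (hN1 : U.Fact_cupExterior) (hN2 : U.Fact_cup_hodge) (hN3 : U.Fact_pull_H0) (hN4 : U.Fact_hodge_F0)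
    (h4 : U.Fact_cupAlg) (h5 : U.Fact_cupAssoc) (hu : U.Fact_unitH0) (hb : U.Fact_gysinDescentB) (hd : U.Fact_dimProd) :
    COR_CM_of_descentFactsB U M hR hN1 hN2 hN3 hN4 h4 h5 hu hb hd = COR_CM_of_descentFactsB₃ U M hR hN1 hN2 hN3 h4 h5 hu hb hd :=
  rfl

end Assembly

end HodgeCM

end
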